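import Summits.ABC.IUTFork.DAGC312p
import Summits.ABC.IUTFork.Cor312ProvenanceGenuine
import Literature.IUT.LogVolume.Theorem110ToLegendre
import Summits.ABC.ABC.Theorems.IUTThetaPilotThetaPartIIOfThm110

/-!
# Kernel DAG index — layer C312, part w: knitting DELTA 13 — the one node AT THE REAL DATA: provenance replaces the number
identifications, and the landed DOWNSTREAM CHAIN ([IUTchIV] Thm 1.10 ⇒ Cor 2.2 ⇒ Cor 2.3 ⇒ [GenEll] ⇒ `ABC`) BY NAME

index v1 · abc-iut-c312-2 (filer, gen 3) per HOME/plan/KERNEL-DAG-SPEC.md v1.3 §3 (edges with Lean content), §4 rules (2)–(3). PROOF-ONLY,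
APPEND-ONLY. The apex ladder so far (parts o/p/q: `summit_of_cor312_M_SHE'`, `summit_of_cor312_M_xi_f`) runs through the fork SKELETON's
abstract families (`HeightFamily`, `Thm110Family`, `AbcDictionary`, `abc_of_indeterminacies_of_cor312`) and carries two NUMBER IDENTIFICATIONS
per curve (`hΘ`, `hq`). Meanwhile campaign S landed the REAL downstream chain (abc-iut-S3/S4/plan: `Cor22.thm110Legendre_of_matchingNumerics`
— [IUTchIV] Thm 1.10 in the Legendre form from per-point matching numerics `X : Thm110Numerics` with proof data and `X.Cor312`;
`Summit.ABC.ABC.Theorems.ABC_of_thm110Legendre_of_genEllTwo` — Cor 2.2 ⇒ 2.3 ⇒ [GenEll] Thm 2.1 at `Σ = {2}` ⇒ `ABC`, modulo the route's named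
input `GenEllTwo`), and abc-iut-c312-8 landed the PROVENANCE of the verbatim setting (`Cor312Prov.IsSettingOf D P`, `numericsOf D P J`,
`numericsOf_cor312_iff : (numericsOf D P J).Cor312 ↔ P.Statement`; S2-side `statement_iff_cor312Of_of_links`). This part joins them to part p:

* `numericsOf_cor312_iff_xi_f` — for initial Θ-data `D`, a verbatim setting `Pv` OF `D` (`IsSettingOf`), inputs `J`: S3's hypothesis
  `(numericsOf D Pv J).Cor312` ⟺ THE NODE (xi-f) at the readings of record (given `ThetaFinite`, `AbsLogQPos`) — the apex's `hΘ`/`hq`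
  DISCHARGED BY PROVENANCE (the numbers ARE the setting's, by construction);
* `cor312Of_iff_xi_f_of_links` — the same against S2's genuine Θ-volume input `I` OF `D` (`IsVolumeInputOf`), under the one remaining
  identification `hΘ : Pv.negLogTheta = ↑I.negLogTheta` (plan's layer-2 child; C312-RESIDUALS §1a′);
* `E_ABC_of_matchingNumerics_of_GenEllTwo` — the downstream chain as ONE EDGE, by name (S3 ∘ S4/plan);
* **`summit_real_of_xi_f`** — `ABC` from: for every `η_prm`, every `λ ∈ U_X` minimally presented, every prime `l ≥ 5` with core/(P2)/(P5)/(P6):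
  initial Θ-data `D` with a full situation and a verbatim setting OF `D` whose numerics match `(λ, l, η_prm)` with `l ≠ 5`, proof data for
  Thm 1.10, the two side clauses, and THE ONE PRINTED NODE (xi-f) at the readings of record; plus `GenEllTwo`. No skeleton family, no number
  identification, no reading binder: real data + one printed node + one formalisation debt. (The existential is over the Θ-data's carrier
  types at universe 0, as S3's `Thm110Legendre` is.)
THIS FILE PROVES NOTHING NEW about [IUTchIII] §3 AND ASSERTS NOTHING; no side taken on Cor. 3.12. typed ≠ discharged; indexed ≠ endorsed.
[claim: Mochizuki2012, status: disputed]
-/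

noncomputable section

namespace Summit.ABC.IUTFork.DAG

open Cor312Proof Thm311 Cor312Vol Cor312Prov Literature.IUT.LogThetaLattice Literature.IUT.HodgeTheaters
open Literature.IUT.LogVolume Literature.IUT.LogVolume.Cor22 Literature.NumberTheory.DiophantineGeometry.GenEll

section Provenance

variable {F K Fbar : Type} [Field F] [NumberField F] [Field K] [NumberField K] [Algebra F K] [Field Fbar] [Algebra F Fbar]
  [Algebra K Fbar] {E : WeierstrassCurve F} [E.IsElliptic] {l : ℕ} {Pb : BadPlacePredicates K}
variable (D : InitialThetaData F K Fbar E l Pb) {T : ThetaIndex} (S : FullSituation T) (pending : Locus → Prop)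
  (Pv : Cor312.Setting S.toSituation) (Dk : ThetaLinkStrips Pv.LogLink Pv.Strip)

/-- **S3's hypothesis `Thm110Numerics.Cor312` for the numerics OF `(D, Pv)` ⟺ THE NODE (xi-f) at the readings of record**, given that `Pv` IS
the setting of `D` (`IsSettingOf`) and the two side clauses. BY NAME: c312-8's `numericsOf_cor312_iff` and part p's
`N_IUTchIII_Cor3_12_pf_xi_f_iff_statement`. The number identifications `hΘ`/`hq` of the skeleton apexes are thereby PROVENANCE, not hypotheses.
[claim: Mochizuki2012, status: disputed] -/
theorem numericsOf_cor312_iff_xi_f (hP : IsSettingOf D Pv) (J : NumericsInputs D) (hfin : Pv.ThetaFinite) (hqpos : Pv.AbsLogQPos) :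
    (numericsOf D Pv J).Cor312 ↔ N_IUTchIII_Cor3_12_pf_xi_f (lociReadingI S pending) (obsReadingA S pending Pv Dk) :=
  (numericsOf_cor312_iff Pv J hP).trans (N_IUTchIII_Cor3_12_pf_xi_f_iff_statement S pending Pv Dk hfin hqpos).symm

/-- **S2's genuine-input form `ThetaVolumeInput.Cor312Of I` ⟺ THE NODE**, for a genuine Θ-volume input `I` OF `D` and a verbatim setting OF `D`,
under the one remaining identification of the Θ-sides `hΘ` (c312-8's `statement_iff_cor312Of_of_links`). [claim: Mochizuki2012, status: disputed] -/
theorem cor312Of_iff_xi_f_of_links {I : ThetaVolumeInput (fieldOfModuli E) K} (hI : ThetaData.IsVolumeInputOf D I)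
    (hP : IsSettingOf D Pv) (hΘ : Pv.negLogTheta = ((I.negLogTheta : ℝ) : WithTop ℝ)) (hfin : Pv.ThetaFinite) (hqpos : Pv.AbsLogQPos) :
    I.Cor312Of ↔ N_IUTchIII_Cor3_12_pf_xi_f (lociReadingI S pending) (obsReadingA S pending Pv Dk) :=
  (statement_iff_cor312Of_of_links D hI hP hΘ).symm.trans (N_IUTchIII_Cor3_12_pf_xi_f_iff_statement S pending Pv Dk hfin hqpos).symm

end Provenance

/-- **EDGE, the landed downstream chain by name**: per-point matching numerics with proof data and `Cor312` (S3's
`thm110Legendre_of_matchingNumerics`: [IUTchIV] Thm 1.10, Legendre form) and `GenEllTwo` ([GenEll] Thm 2.1 at `Σ = {2}`, the route's named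
debt) give `ABC` (`ABC_of_thm110Legendre_of_genEllTwo`: Cor 2.2 ⇒ Cor 2.3 ⇒ abc). [claim: Mochizuki2012, status: disputed] -/
theorem E_ABC_of_matchingNumerics_of_GenEllTwo
    (H : ∀ η : ℝ, IsEtaPrm η → ∀ Pt : NFPoint, Pt ∈ UP → ∀ l : ℕ, l.Prime → 5 ≤ l →
      AdmitsCore Pt → CondP2 Pt l → CondP5 Pt l → CondP6 Pt l →
        ∃ X : Thm110Numerics, Matches X Pt l η ∧ X.l ≠ 5 ∧ Nonempty X.ProofData ∧ X.Cor312)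
    (hG : Summit.ABC.ABC.Theses.IUTThetaPilot.GenEllTwo) : _root_.ABC :=
  Summit.ABC.ABC.Theorems.ABC_of_thm110Legendre_of_genEllTwo (thm110Legendre_of_matchingNumerics H) hG

/-- **APEX AT THE REAL DATA.** `ABC` from: for every `η_prm`, every minimally presented `λ ∈ U_X`, every prime `l ≥ 5` with "admits an
`F`-core", (P2), (P5), (P6) — initial Θ-data `D` (carrier types at universe 0), a full situation `S` of Theorem 3.11, a verbatim setting
`Pv` that IS the setting of `D`, numerics inputs `J` matching `(λ, l, η_prm)` with `l ≠ 5`, Thm-1.10 proof data, the Corollary's two side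
clauses, and THE ONE PRINTED NODE (xi-f) of the proof of [IUTchIII] Cor. 3.12 at the readings of record —; plus `GenEllTwo`. Every other
step node is a kernel theorem (part p); the downstream chain is kernel-proved (campaign S); no skeleton family, no number identification,
no reading binder. [claim: Mochizuki2012, status: disputed] -/
theorem summit_real_of_xi_f
    (H : ∀ η : ℝ, IsEtaPrm η → ∀ Pt : NFPoint, Pt ∈ UP → ∀ l : ℕ, l.Prime → 5 ≤ l →
      AdmitsCore Pt → CondP2 Pt l → CondP5 Pt l → CondP6 Pt l →
        ∃ (F : Type) (_ : Field F) (_ : NumberField F) (K : Type) (_ : Field K) (_ : NumberField K) (_ : Algebra F K)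
          (Fbar : Type) (_ : Field Fbar) (_ : Algebra F Fbar) (_ : Algebra K Fbar) (E : WeierstrassCurve F) (_ : E.IsElliptic)
          (Pb : BadPlacePredicates K) (D : InitialThetaData F K Fbar E l Pb) (T : ThetaIndex) (S : FullSituation T)
          (Pv : Cor312.Setting S.toSituation) (J : NumericsInputs D) (Dk : ThetaLinkStrips Pv.LogLink Pv.Strip) (pending : Locus → Prop),
          IsSettingOf D Pv ∧ Matches (numericsOf D Pv J) Pt l η ∧ (numericsOf D Pv J).l ≠ 5 ∧ Nonempty (numericsOf D Pv J).ProofData ∧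
            Pv.ThetaFinite ∧ Pv.AbsLogQPos ∧ N_IUTchIII_Cor3_12_pf_xi_f (lociReadingI S pending) (obsReadingA S pending Pv Dk))
    (hG : Summit.ABC.ABC.Theses.IUTThetaPilot.GenEllTwo) : _root_.ABC := by
  refine E_ABC_of_matchingNumerics_of_GenEllTwo (fun η hη Pt hPt l hl h5 hc h2 h5' h6 => ?_) hG
  obtain ⟨F, _, _, K, _, _, _, Fbar, _, _, _, E, _, Pb, D, T, S, Pv, J, Dk, pending, hP, hM, hne, hPD, hfin, hqpos, hnode⟩ :=
    H η hη Pt hPt l hl h5 hc h2 h5' h6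
  exact ⟨numericsOf D Pv J, hM, hne, hPD, (numericsOf_cor312_iff_xi_f D S pending Pv Dk hP J hfin hqpos).2 hnode⟩

end Summit.ABC.IUTFork.DAG

end
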